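import Summits.BirchSwinnertonDyer.Rank1Residual.P2.CMKolyvaginCartanCommuteAtTwoLevel
import Summits.BirchSwinnertonDyer.Rank1Residual.P2.CMKolyvaginHabitatInertAtlas
import Literature.NumberTheory.EllipticCurves.ComplexMultiplicationDeuringReductionCoxEndProofs
import Literature.NumberTheory.EllipticCurves.ThreeIsogenyKernelX
import Literature.NumberTheory.EllipticCurves.QuadraticTwistJInvariantProofs
import Literature.NumberTheory.EllipticCurves.QuadraticTwistSelmerPInfty
import Literature.NumberTheory.EllipticCurves.TateModuleGaloisTransportProofs
import HarnessLib

/-!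
# Route `CMKolyvaginAtInertTwo`, crux `CMKolyvaginExactAtInertTwo` (stmt-BirchSwinnertonDyer-24277):
# the binder `hcomm` DISCHARGED on the habitat `H₂` (part 3/3: CM curves over `ℚ` with `2` inert,
# and base change to number fields — the consumers' hypothesis verbatim)

Cell `bsd-print-cf2`, seat ty2 (discharge interface). HONEST FRAMING: THEOREMS ONLY — no definition,
no named fact, no route file imported, nothing about BSD asserted; no item is closed by this file.
Continuation of `CMKolyvaginCartanCommuteAtTwo{,Level}` (the engine: a CM generator `η` with
`η² + mη = c`, `m`, `c` odd, makes fixed-point-free and `E[2]`-trivial Galois elements commute on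
`E[2^M]`). Here the generator is SUPPLIED on the habitat and the conclusion is moved to `E_K(K̄)`:

* `exists_cmGenerator_of_mem_maximalCMJInvariants` — for the nine maximal CM `j`: `η = ι₀(ω_d)` under
  the tree's PROVED `ι₀ : ℤ[ω_d] ≅ End_{ℚ̄}(E)` (`Cox2013_exists_ringEquiv_cmRing_geomEndRing_holds`),
  `η² − dη = −d(d−1)/4` (`cmGen_sq`); for `d ∈ {−3, −11, −19, −43, −67, −163}` (`2` inert) both `d` and
  `d(d−1)/4` are odd (`smul_comm_of_mem_maximalCMJInvariants`);
* `smul_comm_of_j_eq_neg_12288000` — the order `ℤ[3ζ₃]` (conductor `3`; the twists of `27a4`): every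
  such curve is `ℚ`-isomorphic to `E_d = [0, 36d, 0, −48d², 16d³]`
  (`exists_variableChange_eq_quadraticTwist_of_j_eq`), and the tree's kernel-`x` `3`-isogeny
  `E_d → [0, 36d, 0, 432d², 13392d³]` (`IsKernelXThreePair.toIsogeny`, Vélu; `j = 0` target, kernel
  of order `3`) is `Γ_ℚ`-equivariant and injective on `2`-power torsion: PULL BACK;
* `smul_comm_of_hasCM_of_cmInert_two` — `HasCM ∧ CMInert W 2 ∧ j ≠ 54000` over `ℚ` (the table
  `cmInert_two_iff_of_hasCM`, `X12.j_eq_of_cmFieldDiscrOfJ_eq_neg_*`); for `j = 54000` (order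
  `ℤ[√−3]`, a rational `2`-torsion point) the fixed-point-free hypothesis is never met;
* **`hcomm_of_hasCM_of_cmInert_two`**, **`hcomm_of_habitat`** — PUSH FORWARD to `E_K(K̄)` along the
  equivariant identification `E(ℚ̄) ≃ E_K(K̄)` over `res : Γ_K → Γ_ℚ`
  (`WeierstrassCurve.exists_addEquiv_geomPoints_baseChange`): for `W/ℚ` with CM, `CMInert W 2`,
  `ρ̄_{W,2}` onto (or just `j ≠ 54000`), ANY number field `K`, any `z ∈ Γ_K` without non-zero fixed
  point on `E_K[2]`:
  `∀ π ∈ torsionFixing (W.baseChange K) 2, ∀ P : geomTorsion (W.baseChange K) (2^M), π • z • P = z • π • P`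
  — the binder `hcomm` of `KolyvaginImageTwo.h1_restriction_injective_two_pow`,
  `exists_h1Eval_eq_two_pow`, the level-`2^M` Čebotarev leaf and the `(−ε)`/`τ`/entangled descents,
  by name (scratch-checked against `h1_restriction_injective_two_pow`).

beyond-print theorem: NO (Lang Ch. 10 §4 Remark at `2`-power level + the tree's CM/isogeny theorems).
BSD is not proved by any of this; no summit statement is proved by this seat.

References: S. Lang, *Elliptic Functions*, GTM 112 (1987), Ch. 10 §4 Remark [Lang1987]; D. A. Cox,
*Primes of the form x² + ny²*, 2nd ed. (2013), §14.B–C [Cox2013]; J. E. Cremona, *Algorithms*, §3.8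
(Vélu) [CremonaAlgorithms1997]; J. H. Silverman, *Advanced Topics*, App. A §3 [SilvermanATAEC1994];
B. Gross, LMS LN 153 (1991), §9 [GrossLMS1991]; W. McCallum, ibid., §3 [McCallumLMS1991].
-/

set_option autoImplicit false

noncomputable section

open scoped Classical

namespace Summit.BirchSwinnertonDyer.Rank1Residual.P2.CartanAtTwo

open WeierstrassCurve Field
open Literature.NumberTheory.EllipticCurves

universe u

/-! ## §8 The habitat: CM curves over `ℚ` with `2` inert, and the binder `hcomm` over `K` -/

section Rational

open Literature.NumberTheory.GaloisRepresentations Literature.NumberTheory.EllipticCurves.Rank1Residual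

variable (W : WeierstrassCurve ℚ) [W.IsElliptic]

/-- **The CM generator for the maximal orders.** For `E/ℚ` with `j(E)` one of the nine maximal CM
values and `d = cmDiscr j(E)`, `4c = d(d−1)`: the image `η = ι₀(ω_d)` of `ω_d = (d + √d)/2` under the
tree's ring isomorphism `ι₀ : ℤ[ω_d] ≅ End_{ℚ̄}(E)` (`Cox2013_exists_ringEquiv_cmRing_geomEndRing_holds`)
satisfies `η² + (−d)η = −c` (`cmGen_sq`: `ω_d² = dω_d − c`).
[cite: Cox2013, Thm. 14.16 and §14.B Prop. 14.9] [cite: Lang1987, Ch. 10 §4, Remark] -/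
theorem exists_cmGenerator_of_mem_maximalCMJInvariants (hj : W.j ∈ maximalCMJInvariants) {c : ℤ}
    (hc : cmDiscr W.j * (cmDiscr W.j - 1) = 4 * c) :
    ∃ η ∈ W.geomEndRing,
      η * η + ((-cmDiscr W.j : ℤ) : AddMonoid.End (geomPoints W)) * η =
        ((-c : ℤ) : AddMonoid.End (geomPoints W)) := by
  obtain ⟨ι₀, -⟩ := Cox2013_exists_ringEquiv_cmRing_geomEndRing_holds W hj
  have hd0 : cmDiscr W.j ≤ 0 := (neg_and_exists_of_mem_cmDiscrs (cmDiscr_mem_cmDiscrs hj)).1.le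
  set ω : cmRing (cmDiscr W.j) := ⟨cmGen (cmDiscr W.j), cmGen_mem_cmRing _⟩ with hωdef
  have hω : ω * ω = (cmDiscr W.j : cmRing (cmDiscr W.j)) * ω - (c : cmRing (cmDiscr W.j)) :=
    Subtype.ext (by push_cast; rw [hωdef, ← pow_two]; exact cmGen_sq hd0 hc)
  refine ⟨(ι₀ ω : AddMonoid.End (geomPoints W)), (ι₀ ω).2, ?_⟩
  have h := congrArg (fun x : W.geomEndRing ↦ (x : AddMonoid.End (geomPoints W))) (congrArg ι₀ hω)
  simp only [map_mul, map_sub, map_intCast] at h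
  push_cast at h
  rw [h, Int.cast_neg, Int.cast_neg, neg_mul]
  abel

/-- **`hcomm` over `ℚ` on the six maximal inert orders** (`j ∈ {0, −2¹⁵, −2¹⁵3³, −2¹⁸3³5³,
−2¹⁵3³5³11³, −2¹⁸3³5³23³29³}`, `d ≡ 5 (mod 8)`): two elements of `Γ_ℚ`, one without non-zero fixed
point on `E[2]` and one trivial on `E[2]`, commute on `E[2^M]`. [cite: Lang1987, Ch. 10 §4, Remark] -/
theorem smul_comm_of_mem_maximalCMJInvariants (hj : W.j ∈ maximalCMJInvariants) {d c : ℤ}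
    (hd : cmDiscr W.j = d) (hc : d * (d - 1) = 4 * c) (hodd : Odd d) (hoddc : Odd c)
    (M : ℕ) (σ τ : absoluteGaloisGroup ℚ)
    (hσ : ∀ P : geomPoints W, (2 : ℤ) • P = 0 → σ • P = P → P = 0)
    (hτ : ∀ P : geomPoints W, (2 : ℤ) • P = 0 → τ • P = P)
    (P : geomPoints W) (hP : ((2 ^ M : ℕ) : ℤ) • P = 0) : τ • σ • P = σ • τ • P := by
  subst hd
  obtain ⟨η, hη, hrel⟩ := exists_cmGenerator_of_mem_maximalCMJInvariants W hj hc
  exact smul_comm_of_cmGenerator W hη hrel hodd.neg hoddc.neg M σ τ hσ hτ P hP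

/-- An element of a subgroup of order `3` which is `2`-power torsion is `0`. [folklore] -/
theorem eq_zero_of_mem_ker_three {A : Type*} [AddCommGroup A] {H : AddSubgroup A}
    (hH : Nat.card H = 3) {Q : A} (hQ : Q ∈ H) {n : ℕ} (h2 : ((2 ^ n : ℕ) : ℤ) • Q = 0) : Q = 0 := by
  haveI : Finite H := Nat.finite_of_card_ne_zero (by rw [hH]; norm_num)
  have h3 : (3 : ℤ) • Q = 0 := by
    have h := addOrderOf_dvd_natCard (⟨Q, hQ⟩ : H)
    rw [hH, addOrderOf_dvd_iff_nsmul_eq_zero] at h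
    have h' : (3 : ℕ) • Q = 0 := congrArg Subtype.val h
    exact_mod_cast h'
  have hcop : IsCoprime (3 : ℤ) (2 ^ n) :=
    (Int.isCoprime_iff_gcd_eq_one.mpr (by norm_num)).pow_right
  obtain ⟨u, v, huv⟩ := hcop
  have h2' : (2 : ℤ) ^ n • Q = 0 := by exact_mod_cast h2
  calc Q = (u * 3 + v * 2 ^ n) • Q := by rw [huv, one_zsmul]
    _ = 0 := by rw [add_zsmul, mul_zsmul, mul_zsmul, h3, h2', zsmul_zero, zsmul_zero, add_zero]

/-- **`hcomm` over `ℚ` for `j = −12288000`** (CM by `ℤ[3ζ₃]`, the order of conductor `3`; the twists of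
`27a4`): every such curve is `ℚ`-isomorphic to `E_d = [0, 36d, 0, −48d², 16d³]`
(`exists_variableChange_eq_quadraticTwist_of_j_eq`), whose kernel-`x` `3`-isogeny
`E_d → E'_d = [0, 36d, 0, 432d², 13392d³]` (`IsKernelXThreePair.toIsogeny`; Vélu) is defined over `ℚ`,
has kernel of order `3` (so is injective on `2`-power torsion) and lands on a curve with `j = 0`;
pull back §5 along it and along the `ℚ`-isomorphism. [cite: Lang1987, Ch. 10 §4, Remark]
[cite: CremonaAlgorithms1997, §3.8 (Vélu's formulae)] -/
theorem smul_comm_of_j_eq_neg_12288000 (hj : W.j = -12288000)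
    (M : ℕ) (σ τ : absoluteGaloisGroup ℚ)
    (hσ : ∀ P : geomPoints W, (2 : ℤ) • P = 0 → σ • P = P → P = 0)
    (hτ : ∀ P : geomPoints W, (2 : ℤ) • P = 0 → τ • P = P)
    (P : geomPoints W) (hP : ((2 ^ M : ℕ) : ℤ) • P = 0) : τ • σ • P = σ • τ • P := by
  -- the reference model `E₁ = [0, 36, 0, -48, 16]`, `j = -12288000`
  haveI hE₁ : (⟨0, 36, 0, -48, 16⟩ : WeierstrassCurve ℚ).IsElliptic :=
    ⟨isUnit_iff_ne_zero.mpr (by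
      norm_num [WeierstrassCurve.Δ, WeierstrassCurve.b₂, WeierstrassCurve.b₄, WeierstrassCurve.b₆,
        WeierstrassCurve.b₈])⟩
  have hjE₁ : (⟨0, 36, 0, -48, 16⟩ : WeierstrassCurve ℚ).j = -12288000 := by
    rw [j, Units.inv_mul_eq_iff_eq_mul, coe_Δ']
    norm_num [WeierstrassCurve.c₄, WeierstrassCurve.Δ, WeierstrassCurve.b₂, WeierstrassCurve.b₄,
      WeierstrassCurve.b₆, WeierstrassCurve.b₈]
  obtain ⟨d, hd, C, hC⟩ := exists_variableChange_eq_quadraticTwist_of_j_eq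
    (W := W) (E := (⟨0, 36, 0, -48, 16⟩ : WeierstrassCurve ℚ)) (by rw [hj, hjE₁])
    (by rw [hjE₁]; norm_num) (by rw [hjE₁]; norm_num)
  have hV : (⟨0, 36, 0, -48, 16⟩ : WeierstrassCurve ℚ).quadraticTwist d =
      ⟨0, 36 * d, 0, -48 * d ^ 2, 16 * d ^ 3⟩ := by
    ext <;> simp [WeierstrassCurve.quadraticTwist, WeierstrassCurve.b₂, WeierstrassCurve.b₄,
      WeierstrassCurve.b₆] <;> ring
  rw [hV] at hC
  -- the kernel-`x` model `V = E_d` and Vélu's quotient `V'`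
  set V : WeierstrassCurve ℚ := ⟨0, 36 * d, 0, -48 * d ^ 2, 16 * d ^ 3⟩ with hVdef
  have hΔV : V.Δ = -995328 * d ^ 6 := by
    simp only [hVdef, WeierstrassCurve.Δ, WeierstrassCurve.b₂, WeierstrassCurve.b₄,
      WeierstrassCurve.b₆, WeierstrassCurve.b₈]
    ring
  have hΔV0 : V.Δ ≠ 0 := by rw [hΔV]; exact mul_ne_zero (by norm_num) (pow_ne_zero 6 hd)
  haveI hVell : V.IsElliptic := ⟨isUnit_iff_ne_zero.mpr hΔV0⟩
  have hpair : IsKernelXThreePair (36 * d) (-48 * d ^ 2) (16 * d ^ 3) V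
      (kernelXThreeCodomain (36 * d) (-48 * d ^ 2) (16 * d ^ 3)) :=
    isKernelXThreePair_mk (by ring) hΔV0
  set V' : WeierstrassCurve ℚ := kernelXThreeCodomain (36 * d) (-48 * d ^ 2) (16 * d ^ 3) with hV'def
  haveI hV'ell : V'.IsElliptic := ⟨isUnit_iff_ne_zero.mpr hpair.Δ'_ne⟩
  have hc4 : V'.c₄ = 0 := by
    simp only [hV'def, WeierstrassCurve.c₄, WeierstrassCurve.b₂, WeierstrassCurve.b₄,
      kernelXThreeCodomain_a₁, kernelXThreeCodomain_a₂, kernelXThreeCodomain_a₃,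
      kernelXThreeCodomain_a₄]
    ring
  have hjV' : V'.j = 0 := by rw [j, hc4]; ring
  -- `hcomm` over `ℚ` on `V'` (`j = 0`, maximal order `ℤ[ζ₃]`, `d = -3`, `c = 3`)
  have hV'comm := smul_comm_of_mem_maximalCMJInvariants V' (by rw [hjV']; simp [maximalCMJInvariants])
    (d := -3) (c := 3) (by rw [hjV']; norm_num [cmDiscr]) (by norm_num) (by decide) (by decide) M
  -- pull back along Vélu's isogeny `φ : V → V'`
  have hφinj : ∀ (n : ℕ) (Q : geomPoints V), ((2 ^ n : ℕ) : ℤ) • Q = 0 →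
      hpair.toIsogeny.toAddMonoidHom Q = 0 → Q = 0 := fun n Q h2 h0 ↦
    eq_zero_of_mem_ker_three hpair.natCard_ker_toIsogeny ((AddMonoidHom.mem_ker).mpr h0) h2
  have hVcomm : ∀ σ' τ' : absoluteGaloisGroup ℚ,
      (∀ Q : geomPoints V, (2 : ℤ) • Q = 0 → σ' • Q = Q → Q = 0) →
      (∀ Q : geomPoints V, (2 : ℤ) • Q = 0 → τ' • Q = Q) →
      ∀ Q : geomPoints V, ((2 ^ M : ℕ) : ℤ) • Q = 0 → τ' • σ' • Q = σ' • τ' • Q :=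
    fun σ' τ' hσ' hτ' Q hQ ↦ smul_comm_pull hpair.toIsogeny.toAddMonoidHom
      hpair.toIsogeny.equivariant hφinj (natCard_geomTorsion_two_pow V)
      (natCard_geomTorsion_two_pow V') M hV'comm hσ' hτ' Q hQ
  -- pull back along the `ℚ`-isomorphism `W ≅ V`
  exact smul_comm_pull (twistPointsIso hC).toAddMonoidHom (fun γ Q ↦ twistPointsIso_smul hC γ Q)
    (fun n Q _ h0 ↦ (twistPointsIso hC).map_eq_zero_iff.mp h0) (natCard_geomTorsion_two_pow W)
    (natCard_geomTorsion_two_pow V) M hVcomm hσ hτ P hP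

/-- **`hcomm` over `ℚ` on the habitat**: `E/ℚ` with CM, `2` inert in the CM field, `j ≠ 54000`
(the CM order is then `ℤ[ω_d]`, `d ∈ {−3, −11, −19, −43, −67, −163}`, or `ℤ[3ζ₃]`; in each `2` is inert):
an element of `Γ_ℚ` without non-zero fixed point on `E[2]` and an element trivial on `E[2]` commute on
`E[2^M]`. (For `j = 54000`, order `ℤ[√−3]` of conductor `2`, `E[2]` has a rational point and the
hypothesis on `z` is never met.) [cite: Lang1987, Ch. 10 §4, Remark] [cite: SilvermanATAEC1994, App. A §3] -/
theorem smul_comm_of_hasCM_of_cmInert_two (hCM : W.HasCM) (hin : CMInert W 2) (h54 : W.j ≠ 54000)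
    (M : ℕ) (σ τ : absoluteGaloisGroup ℚ)
    (hσ : ∀ P : geomPoints W, (2 : ℤ) • P = 0 → σ • P = P → P = 0)
    (hτ : ∀ P : geomPoints W, (2 : ℤ) • P = 0 → τ • P = P)
    (P : geomPoints W) (hP : ((2 ^ M : ℕ) : ℤ) • P = 0) : τ • σ • P = σ • τ • P := by
  rcases (cmInert_two_iff_of_hasCM (hcm := hCM)).1 hin with h | h | h | h | h | h
  · rcases X12.j_eq_of_cmFieldDiscrOfJ_eq_neg_three h with hj | hj | hj
    · exact smul_comm_of_mem_maximalCMJInvariants W (by rw [hj]; simp [maximalCMJInvariants])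
        (d := -3) (c := 3) (by rw [hj]; norm_num [cmDiscr]) (by norm_num) (by decide) (by decide)
        M σ τ hσ hτ P hP
    · exact absurd hj h54
    · exact smul_comm_of_j_eq_neg_12288000 W hj M σ τ hσ hτ P hP
  · have hj := X12.j_eq_of_cmFieldDiscrOfJ_eq_neg_eleven h
    exact smul_comm_of_mem_maximalCMJInvariants W (by rw [hj]; simp [maximalCMJInvariants])
      (d := -11) (c := 33) (by rw [hj]; norm_num [cmDiscr]) (by norm_num) (by decide) (by decide)
      M σ τ hσ hτ P hP
  · have hj := X12.j_eq_of_cmFieldDiscrOfJ_eq_neg_nineteen h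
    exact smul_comm_of_mem_maximalCMJInvariants W (by rw [hj]; simp [maximalCMJInvariants])
      (d := -19) (c := 95) (by rw [hj]; norm_num [cmDiscr]) (by norm_num) (by decide) (by decide)
      M σ τ hσ hτ P hP
  · have hj := X12.j_eq_of_cmFieldDiscrOfJ_eq_neg_fortythree h
    exact smul_comm_of_mem_maximalCMJInvariants W (by rw [hj]; simp [maximalCMJInvariants])
      (d := -43) (c := 473) (by rw [hj]; norm_num [cmDiscr]) (by norm_num) (by decide) (by decide)
      M σ τ hσ hτ P hP
  · have hj := X12.j_eq_of_cmFieldDiscrOfJ_eq_neg_sixtyseven h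
    exact smul_comm_of_mem_maximalCMJInvariants W (by rw [hj]; simp [maximalCMJInvariants])
      (d := -67) (c := 1139) (by rw [hj]; norm_num [cmDiscr]) (by norm_num) (by decide) (by decide)
      M σ τ hσ hτ P hP
  · have hj := X12.j_eq_of_cmFieldDiscrOfJ_eq_neg_onesixtythree h
    exact smul_comm_of_mem_maximalCMJInvariants W (by rw [hj]; simp [maximalCMJInvariants])
      (d := -163) (c := 6683) (by rw [hj]; norm_num [cmDiscr]) (by norm_num) (by decide) (by decide)
      M σ τ hσ hτ P hP

/-- **THE DISCHARGE OF `hcomm` (base change to a number field `K`).** For `E/ℚ` with CM, `2` inert in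
the CM field and `j ≠ 54000`, any number field `K`, any `z ∈ Γ_K` without non-zero fixed point on
`E_K[2]`, any `π ∈ Γ_{K(E[2])}` and any `P ∈ E_K[2^M]`: `π z P = z π P` — the hypothesis `hcomm` of
`KolyvaginImageTwo.h1_restriction_injective_two_pow` / `exists_h1Eval_eq_two_pow` and of the
level-`2^M` descents of the route, VERBATIM. Over `ℚ` by `smul_comm_of_hasCM_of_cmInert_two`; pushed to
`E_K(K̄)` along the equivariant identification `E(ℚ̄) ≃ E_K(K̄)` over `res : Γ_K → Γ_ℚ`
(`WeierstrassCurve.exists_addEquiv_geomPoints_baseChange`). [cite: Lang1987, Ch. 10 §4, Remark]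
[cite: GrossLMS1991, §9 Prop. 9.1] -/
theorem hcomm_of_hasCM_of_cmInert_two (K : Type) [Field K] [NumberField K] (hCM : W.HasCM)
    (hin : CMInert W 2) (h54 : W.j ≠ 54000) {M : ℕ} {z : absoluteGaloisGroup K}
    (hz : ∀ P : geomTorsion (W.baseChange K) ((2 : ℕ) : ℤ), z • P = P → P = 0)
    {π : absoluteGaloisGroup K} (hπ : π ∈ torsionFixing (W.baseChange K) ((2 : ℕ) : ℤ))
    (P : geomTorsion (W.baseChange K) ((2 ^ M : ℕ) : ℤ)) : π • z • P = z • π • P := by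
  haveI : (W.baseChange K).IsElliptic := by rw [baseChange]; infer_instance
  obtain ⟨e, he⟩ := WeierstrassCurve.exists_addEquiv_geomPoints_baseChange W K
  have mem : ∀ {R : geomPoints (W.baseChange K)}, (2 : ℤ) • R = 0 →
      R ∈ geomTorsion (W.baseChange K) ((2 : ℕ) : ℤ) := fun h ↦ by
    rw [mem_geomTorsion_iff]; exact_mod_cast h
  have hz' : ∀ Q : geomPoints (W.baseChange K), (2 : ℤ) • Q = 0 → z • Q = Q → Q = 0 :=
    fun Q h2 hfix ↦ congrArg Subtype.val (hz ⟨Q, mem h2⟩ (Subtype.ext hfix))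
  have hπ' : ∀ Q : geomPoints (W.baseChange K), (2 : ℤ) • Q = 0 → π • Q = Q := fun Q h2 ↦
    congrArg Subtype.val ((mem_torsionFixing_iff (W.baseChange K) _).mp hπ ⟨Q, mem h2⟩)
  apply Subtype.ext
  simp only [AddSubgroup.torsionBy.coe_smul]
  exact smul_comm_push e.toAddMonoidHom (fun γ ↦ absGaloisRestrict ℚ K γ) (fun γ Q ↦ he γ Q)
    (fun n Q _ h0 ↦ e.map_eq_zero_iff.mp h0) (natCard_geomTorsion_two_pow W)
    (natCard_geomTorsion_two_pow (W.baseChange K)) M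
    (fun σ τ hσ hτ Q hQ ↦ smul_comm_of_hasCM_of_cmInert_two W hCM hin h54 M σ τ hσ hτ Q hQ) hz' hπ'
    (P : geomPoints (W.baseChange K)) ((mem_geomTorsion_iff _ _ _).mp P.2)

/-- **`hcomm` ON THE HABITAT `H₂`** (`HasCM ∧ CMInert W 2 ∧ ρ̄_{W,2}` onto; `j = 54000` is off by the
image binder, `InertAtlas.not_hasSurjectiveModNGaloisRep_two_of_j_eq_54000`): the binder of the
level-`2^M` Kolyvagin machine at `p = 2`, in the consumers' exact shape.
[cite: Lang1987, Ch. 10 §4, Remark] [cite: GrossLMS1991, §9 Prop. 9.1] [cite: McCallumLMS1991, §3 (2)] -/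
theorem hcomm_of_habitat (K : Type) [Field K] [NumberField K] (hCM : W.HasCM) (hin : CMInert W 2)
    (hsurj : W.HasSurjectiveModNGaloisRep 2) {M : ℕ} {z : absoluteGaloisGroup K}
    (hz : ∀ P : geomTorsion (W.baseChange K) ((2 : ℕ) : ℤ), z • P = P → P = 0) :
    ∀ π ∈ torsionFixing (W.baseChange K) ((2 : ℕ) : ℤ),
      ∀ P : geomTorsion (W.baseChange K) ((2 ^ M : ℕ) : ℤ), π • z • P = z • π • P :=
  fun _ hπ P ↦ hcomm_of_hasCM_of_cmInert_two W K hCM hin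
    (fun hj ↦ InertAtlas.not_hasSurjectiveModNGaloisRep_two_of_j_eq_54000 W hj hsurj) hz hπ P

end Rational

end Summit.BirchSwinnertonDyer.Rank1Residual.P2.CartanAtTwo

end
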